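import Mathlib
import Summits.Ventures.PercRepro2.K5HyperDigits

/-!
# THE STAR COMPARISONS AS COEFFICIENT INEQUALITIES AT EVERY `K₅` PROFILE
(blind cell PercRepro2, typer-1 g10; mine-1 §23.1 `M(H, T, e)` and `TvT-(ii)`)

The Kronecker numbers of `K5Hyper.lean` are encodings `Σ_k c k · KB3^{idx4 k}` of MASKED TRIPLE COUNTS
(`kron3_mul_mul`): `cPosOn S₁ S₂ S₃ k = cnt3 (ABO ∘ S₁) (Q ∘ S₂) (PD ∘ S₃) k + cnt3 (QB ∘ S₁) (PDoU ∘ S₂) (A ∘ S₃) k`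
is the number of positive triples of the cleared (ii) of profile `k` with the masks forced open copy by
copy, and `cPosT1`, `cPosT1e1`, `cPosE3` (and the `cNeg…`) sum them over the placements of the extra
edges (`posOn_eq`, …, `kNegTvT_eq`).  The coefficients are below `KB3` (`≤ 60 · 3^10`, `cPosTvT_lt`, …),
so `le_of_certLE` reads the comparisons off the certificates:

* **`cNegM_le_cPosM`**: `CertLE (kNegM D P) (kPosM D P) → ∀ k, cNegM D P k ≤ cPosM D P k` — the comparison
  `M(H, T, e) = N(H + T(1) + e(1)) − N(H + T(1)) ≥ 0` at every `K₅` profile, for the hyperedge mask `D` and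
  the pair mask `P`;
* **`cNegTvT_le_cPosTvT`**: `CertLE (kNegTvT a b c) (kPosTvT a b c) → ∀ k, cNegTvT a b c k ≤ cPosTvT a b c k` —
  `TvT-(ii) = N(H + △(1,1,1)) − N(H + T(1)) ≥ 0` at every `K₅` profile.

The `40` instantiations at the kernel certificates are `K5HyperStars.lean`.
-/

namespace Summit.Ventures.PercRepro2

namespace K5

/-! ## The masked triple counts of the star comparisons -/

section Coefficients

/-- The masked triple count: the tables seen through the masks, copy by copy. -/
def cOn (T₁ T₂ T₃ : (Fin 10 → Bool) → Bool) (S₁ S₂ S₃ : Fin 10 → Bool) (k : Fin 10 → Fin 4) : ℕ :=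
  cnt3 (fun ω => T₁ (orOn S₁ ω)) (fun ω => T₂ (orOn S₂ ω)) (fun ω => T₃ (orOn S₃ ω)) k

/-- The positive triples of the cleared (ii) on the pattern `(S₁, S₂, S₃)`. -/
def cPosOn (S₁ S₂ S₃ : Fin 10 → Bool) (k : Fin 10 → Fin 4) : ℕ :=
  cOn tABO tQ tPD S₁ S₂ S₃ k + cOn tQB tPDoU tA S₁ S₂ S₃ k

/-- The negative triples of the cleared (ii) on the pattern `(S₁, S₂, S₃)`. -/
def cNegOn (S₁ S₂ S₃ : Fin 10 → Bool) (k : Fin 10 → Fin 4) : ℕ :=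
  cOn tQB tAO tPD S₁ S₂ S₃ k + cOn tAB tPDoU tQ S₁ S₂ S₃ k

/-- `N(H + D(1))`, positive triples. -/
def cPosT1 (D : Fin 10 → Bool) (k : Fin 10 → Fin 4) : ℕ :=
  cPosOn D mNone mNone k + cPosOn mNone D mNone k + cPosOn mNone mNone D k

/-- `N(H + D(1))`, negative triples. -/
def cNegT1 (D : Fin 10 → Bool) (k : Fin 10 → Fin 4) : ℕ :=
  cNegOn D mNone mNone k + cNegOn mNone D mNone k + cNegOn mNone mNone D k

/-- `N(H + D(1) + P(1))`, positive triples. -/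
def cPosT1e1 (D P : Fin 10 → Bool) (k : Fin 10 → Fin 4) : ℕ :=
  cPosOn (mOr D P) mNone mNone k + cPosOn D P mNone k + cPosOn D mNone P k + cPosOn P D mNone k +
    cPosOn mNone (mOr D P) mNone k + cPosOn mNone D P k + cPosOn P mNone D k + cPosOn mNone P D k +
    cPosOn mNone mNone (mOr D P) k

/-- `N(H + D(1) + P(1))`, negative triples. -/
def cNegT1e1 (D P : Fin 10 → Bool) (k : Fin 10 → Fin 4) : ℕ :=
  cNegOn (mOr D P) mNone mNone k + cNegOn D P mNone k + cNegOn D mNone P k + cNegOn P D mNone k +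
    cNegOn mNone (mOr D P) mNone k + cNegOn mNone D P k + cNegOn P mNone D k + cNegOn mNone P D k +
    cNegOn mNone mNone (mOr D P) k

/-- `N(H + P₁(1) + P₂(1) + P₃(1))`, positive triples, `P₁` in the copy `0`. -/
def cPosE3a (P₁ P₂ P₃ : Fin 10 → Bool) (k : Fin 10 → Fin 4) : ℕ :=
  cPosOn (mOr (mOr P₁ P₂) P₃) mNone mNone k + cPosOn (mOr P₁ P₂) P₃ mNone k +
    cPosOn (mOr P₁ P₂) mNone P₃ k + cPosOn (mOr P₁ P₃) P₂ mNone k + cPosOn P₁ (mOr P₂ P₃) mNone k +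
    cPosOn P₁ P₂ P₃ k + cPosOn (mOr P₁ P₃) mNone P₂ k + cPosOn P₁ P₃ P₂ k + cPosOn P₁ mNone (mOr P₂ P₃) k

/-- `P₁` in the copy `1`. -/
def cPosE3b (P₁ P₂ P₃ : Fin 10 → Bool) (k : Fin 10 → Fin 4) : ℕ :=
  cPosOn (mOr P₂ P₃) P₁ mNone k + cPosOn P₂ (mOr P₁ P₃) mNone k + cPosOn P₂ P₁ P₃ k +
    cPosOn P₃ (mOr P₁ P₂) mNone k + cPosOn mNone (mOr (mOr P₁ P₂) P₃) mNone k +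
    cPosOn mNone (mOr P₁ P₂) P₃ k + cPosOn P₃ P₁ P₂ k + cPosOn mNone (mOr P₁ P₃) P₂ k +
    cPosOn mNone P₁ (mOr P₂ P₃) k

/-- `P₁` in the copy `2`. -/
def cPosE3c (P₁ P₂ P₃ : Fin 10 → Bool) (k : Fin 10 → Fin 4) : ℕ :=
  cPosOn (mOr P₂ P₃) mNone P₁ k + cPosOn P₂ P₃ P₁ k + cPosOn P₂ mNone (mOr P₁ P₃) k +
    cPosOn P₃ P₂ P₁ k + cPosOn mNone (mOr P₂ P₃) P₁ k + cPosOn mNone P₂ (mOr P₁ P₃) k +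
    cPosOn P₃ mNone (mOr P₁ P₂) k + cPosOn mNone P₃ (mOr P₁ P₂) k + cPosOn mNone mNone (mOr (mOr P₁ P₂) P₃) k

/-- `N(H + P₁(1) + P₂(1) + P₃(1))`, positive triples. -/
def cPosE3 (P₁ P₂ P₃ : Fin 10 → Bool) (k : Fin 10 → Fin 4) : ℕ :=
  cPosE3a P₁ P₂ P₃ k + cPosE3b P₁ P₂ P₃ k + cPosE3c P₁ P₂ P₃ k

/-- `N(H + P₁(1) + P₂(1) + P₃(1))`, negative triples, `P₁` in the copy `0`. -/
def cNegE3a (P₁ P₂ P₃ : Fin 10 → Bool) (k : Fin 10 → Fin 4) : ℕ :=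
  cNegOn (mOr (mOr P₁ P₂) P₃) mNone mNone k + cNegOn (mOr P₁ P₂) P₃ mNone k +
    cNegOn (mOr P₁ P₂) mNone P₃ k + cNegOn (mOr P₁ P₃) P₂ mNone k + cNegOn P₁ (mOr P₂ P₃) mNone k +
    cNegOn P₁ P₂ P₃ k + cNegOn (mOr P₁ P₃) mNone P₂ k + cNegOn P₁ P₃ P₂ k + cNegOn P₁ mNone (mOr P₂ P₃) k

/-- `P₁` in the copy `1`. -/
def cNegE3b (P₁ P₂ P₃ : Fin 10 → Bool) (k : Fin 10 → Fin 4) : ℕ :=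
  cNegOn (mOr P₂ P₃) P₁ mNone k + cNegOn P₂ (mOr P₁ P₃) mNone k + cNegOn P₂ P₁ P₃ k +
    cNegOn P₃ (mOr P₁ P₂) mNone k + cNegOn mNone (mOr (mOr P₁ P₂) P₃) mNone k +
    cNegOn mNone (mOr P₁ P₂) P₃ k + cNegOn P₃ P₁ P₂ k + cNegOn mNone (mOr P₁ P₃) P₂ k +
    cNegOn mNone P₁ (mOr P₂ P₃) k

/-- `P₁` in the copy `2`. -/
def cNegE3c (P₁ P₂ P₃ : Fin 10 → Bool) (k : Fin 10 → Fin 4) : ℕ :=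
  cNegOn (mOr P₂ P₃) mNone P₁ k + cNegOn P₂ P₃ P₁ k + cNegOn P₂ mNone (mOr P₁ P₃) k +
    cNegOn P₃ P₂ P₁ k + cNegOn mNone (mOr P₂ P₃) P₁ k + cNegOn mNone P₂ (mOr P₁ P₃) k +
    cNegOn P₃ mNone (mOr P₁ P₂) k + cNegOn mNone P₃ (mOr P₁ P₂) k + cNegOn mNone mNone (mOr (mOr P₁ P₂) P₃) k

/-- `N(H + P₁(1) + P₂(1) + P₃(1))`, negative triples. -/
def cNegE3 (P₁ P₂ P₃ : Fin 10 → Bool) (k : Fin 10 → Fin 4) : ℕ :=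
  cNegE3a P₁ P₂ P₃ k + cNegE3b P₁ P₂ P₃ k + cNegE3c P₁ P₂ P₃ k

/-- The positive side of `M(H, T, e)`: `N(H + T(1) + e(1))⁺ + N(H + T(1))⁻`. -/
def cPosM (D P : Fin 10 → Bool) (k : Fin 10 → Fin 4) : ℕ := cPosT1e1 D P k + cNegT1 D k

/-- The negative side of `M(H, T, e)`. -/
def cNegM (D P : Fin 10 → Bool) (k : Fin 10 → Fin 4) : ℕ := cNegT1e1 D P k + cPosT1 D k

/-- The positive side of `TvT-(ii)`: `N(H + △(1,1,1))⁺ + N(H + T(1))⁻`. -/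
def cPosTvT (a b c : ℕ) (k : Fin 10 → Fin 4) : ℕ :=
  cPosE3 (pairMask a b) (pairMask a c) (pairMask b c) k + cNegT1 (triMask a b c) k

/-- The negative side of `TvT-(ii)`. -/
def cNegTvT (a b c : ℕ) (k : Fin 10 → Fin 4) : ℕ :=
  cNegE3 (pairMask a b) (pairMask a c) (pairMask b c) k + cPosT1 (triMask a b c) k

/-! ### The Kronecker numbers encode the coefficients -/

/-- `posOn` encodes `cPosOn`. -/
lemma posOn_eq (S₁ S₂ S₃ : Fin 10 → Bool) : posOn S₁ S₂ S₃ = ∑ k, cPosOn S₁ S₂ S₃ k * KB3 ^ idx4 k := by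
  unfold posOn
  rw [kron3_mul_mul, kron3_mul_mul, sum_add_mulB]
  rfl

/-- `negOn` encodes `cNegOn`. -/
lemma negOn_eq (S₁ S₂ S₃ : Fin 10 → Bool) : negOn S₁ S₂ S₃ = ∑ k, cNegOn S₁ S₂ S₃ k * KB3 ^ idx4 k := by
  unfold negOn
  rw [kron3_mul_mul, kron3_mul_mul, sum_add_mulB]
  rfl

/-- `posT1` encodes `cPosT1`. -/
lemma posT1_eq (D : Fin 10 → Bool) : posT1 D = ∑ k, cPosT1 D k * KB3 ^ idx4 k := by
  unfold posT1
  simp only [posOn_eq, sum_add_mulB]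
  rfl

/-- `negT1` encodes `cNegT1`. -/
lemma negT1_eq (D : Fin 10 → Bool) : negT1 D = ∑ k, cNegT1 D k * KB3 ^ idx4 k := by
  unfold negT1
  simp only [negOn_eq, sum_add_mulB]
  rfl

/-- `posT1e1` encodes `cPosT1e1`. -/
lemma posT1e1_eq (D P : Fin 10 → Bool) : posT1e1 D P = ∑ k, cPosT1e1 D P k * KB3 ^ idx4 k := by
  unfold posT1e1
  simp only [posOn_eq, sum_add_mulB]
  rfl

/-- `negT1e1` encodes `cNegT1e1`. -/
lemma negT1e1_eq (D P : Fin 10 → Bool) : negT1e1 D P = ∑ k, cNegT1e1 D P k * KB3 ^ idx4 k := by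
  unfold negT1e1
  simp only [negOn_eq, sum_add_mulB]
  rfl

/-- `posE3` encodes `cPosE3`. -/
lemma posE3_eq (P₁ P₂ P₃ : Fin 10 → Bool) : posE3 P₁ P₂ P₃ = ∑ k, cPosE3 P₁ P₂ P₃ k * KB3 ^ idx4 k := by
  unfold posE3 posE3a posE3b posE3c
  simp only [posOn_eq, sum_add_mulB]
  rfl

/-- `negE3` encodes `cNegE3`. -/
lemma negE3_eq (P₁ P₂ P₃ : Fin 10 → Bool) : negE3 P₁ P₂ P₃ = ∑ k, cNegE3 P₁ P₂ P₃ k * KB3 ^ idx4 k := by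
  unfold negE3 negE3a negE3b negE3c
  simp only [negOn_eq, sum_add_mulB]
  rfl

/-- `kPosM` encodes `cPosM`. -/
lemma kPosM_eq (D P : Fin 10 → Bool) : kPosM D P = ∑ k, cPosM D P k * KB3 ^ idx4 k := by
  unfold kPosM
  rw [posT1e1_eq, negT1_eq, sum_add_mulB]
  rfl

/-- `kNegM` encodes `cNegM`. -/
lemma kNegM_eq (D P : Fin 10 → Bool) : kNegM D P = ∑ k, cNegM D P k * KB3 ^ idx4 k := by
  unfold kNegM
  rw [negT1e1_eq, posT1_eq, sum_add_mulB]
  rfl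

/-- `kPosTvT` encodes `cPosTvT`. -/
lemma kPosTvT_eq (a b c : ℕ) : kPosTvT a b c = ∑ k, cPosTvT a b c k * KB3 ^ idx4 k := by
  unfold kPosTvT
  rw [posE3_eq, negT1_eq, sum_add_mulB]
  rfl

/-- `kNegTvT` encodes `cNegTvT`. -/
lemma kNegTvT_eq (a b c : ℕ) : kNegTvT a b c = ∑ k, cNegTvT a b c k * KB3 ^ idx4 k := by
  unfold kNegTvT
  rw [negE3_eq, posT1_eq, sum_add_mulB]
  rfl

/-! ### The coefficients are below `KB3` -/

/-- A masked triple count is at most `3^10`. -/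
lemma cOn_le (T₁ T₂ T₃ : (Fin 10 → Bool) → Bool) (S₁ S₂ S₃ : Fin 10 → Bool) (k : Fin 10 → Fin 4) :
    cOn T₁ T₂ T₃ S₁ S₂ S₃ k ≤ 59049 :=
  cnt3_le _ _ _ k

/-- Two masked counts. -/
lemma cPosOn_le (S₁ S₂ S₃ : Fin 10 → Bool) (k : Fin 10 → Fin 4) : cPosOn S₁ S₂ S₃ k ≤ 2 * 59049 := by
  unfold cPosOn
  have := cOn_le tABO tQ tPD S₁ S₂ S₃ k
  have := cOn_le tQB tPDoU tA S₁ S₂ S₃ k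
  omega

/-- Two masked counts. -/
lemma cNegOn_le (S₁ S₂ S₃ : Fin 10 → Bool) (k : Fin 10 → Fin 4) : cNegOn S₁ S₂ S₃ k ≤ 2 * 59049 := by
  unfold cNegOn
  have := cOn_le tQB tAO tPD S₁ S₂ S₃ k
  have := cOn_le tAB tPDoU tQ S₁ S₂ S₃ k
  omega

/-- Three patterns. -/
lemma cPosT1_le (D : Fin 10 → Bool) (k : Fin 10 → Fin 4) : cPosT1 D k ≤ 6 * 59049 := by
  unfold cPosT1
  have := cPosOn_le D mNone mNone k
  have := cPosOn_le mNone D mNone k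
  have := cPosOn_le mNone mNone D k
  omega

/-- Three patterns. -/
lemma cNegT1_le (D : Fin 10 → Bool) (k : Fin 10 → Fin 4) : cNegT1 D k ≤ 6 * 59049 := by
  unfold cNegT1
  have := cNegOn_le D mNone mNone k
  have := cNegOn_le mNone D mNone k
  have := cNegOn_le mNone mNone D k
  omega

/-- Nine patterns. -/
lemma cPosT1e1_le (D P : Fin 10 → Bool) (k : Fin 10 → Fin 4) : cPosT1e1 D P k ≤ 18 * 59049 := by
  unfold cPosT1e1
  have := cPosOn_le (mOr D P) mNone mNone k
  have := cPosOn_le D P mNone k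
  have := cPosOn_le D mNone P k
  have := cPosOn_le P D mNone k
  have := cPosOn_le mNone (mOr D P) mNone k
  have := cPosOn_le mNone D P k
  have := cPosOn_le P mNone D k
  have := cPosOn_le mNone P D k
  have := cPosOn_le mNone mNone (mOr D P) k
  omega

/-- Nine patterns. -/
lemma cNegT1e1_le (D P : Fin 10 → Bool) (k : Fin 10 → Fin 4) : cNegT1e1 D P k ≤ 18 * 59049 := by
  unfold cNegT1e1
  have := cNegOn_le (mOr D P) mNone mNone k
  have := cNegOn_le D P mNone k
  have := cNegOn_le D mNone P k
  have := cNegOn_le P D mNone k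
  have := cNegOn_le mNone (mOr D P) mNone k
  have := cNegOn_le mNone D P k
  have := cNegOn_le P mNone D k
  have := cNegOn_le mNone P D k
  have := cNegOn_le mNone mNone (mOr D P) k
  omega

/-- Nine patterns. -/
lemma cPosE3a_le (P₁ P₂ P₃ : Fin 10 → Bool) (k : Fin 10 → Fin 4) : cPosE3a P₁ P₂ P₃ k ≤ 18 * 59049 := by
  unfold cPosE3a
  have := cPosOn_le (mOr (mOr P₁ P₂) P₃) mNone mNone k
  have := cPosOn_le (mOr P₁ P₂) P₃ mNone k
  have := cPosOn_le (mOr P₁ P₂) mNone P₃ k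
  have := cPosOn_le (mOr P₁ P₃) P₂ mNone k
  have := cPosOn_le P₁ (mOr P₂ P₃) mNone k
  have := cPosOn_le P₁ P₂ P₃ k
  have := cPosOn_le (mOr P₁ P₃) mNone P₂ k
  have := cPosOn_le P₁ P₃ P₂ k
  have := cPosOn_le P₁ mNone (mOr P₂ P₃) k
  omega

/-- Nine patterns. -/
lemma cPosE3b_le (P₁ P₂ P₃ : Fin 10 → Bool) (k : Fin 10 → Fin 4) : cPosE3b P₁ P₂ P₃ k ≤ 18 * 59049 := by
  unfold cPosE3b
  have := cPosOn_le (mOr P₂ P₃) P₁ mNone k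
  have := cPosOn_le P₂ (mOr P₁ P₃) mNone k
  have := cPosOn_le P₂ P₁ P₃ k
  have := cPosOn_le P₃ (mOr P₁ P₂) mNone k
  have := cPosOn_le mNone (mOr (mOr P₁ P₂) P₃) mNone k
  have := cPosOn_le mNone (mOr P₁ P₂) P₃ k
  have := cPosOn_le P₃ P₁ P₂ k
  have := cPosOn_le mNone (mOr P₁ P₃) P₂ k
  have := cPosOn_le mNone P₁ (mOr P₂ P₃) k
  omega

/-- Nine patterns. -/
lemma cPosE3c_le (P₁ P₂ P₃ : Fin 10 → Bool) (k : Fin 10 → Fin 4) : cPosE3c P₁ P₂ P₃ k ≤ 18 * 59049 := by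
  unfold cPosE3c
  have := cPosOn_le (mOr P₂ P₃) mNone P₁ k
  have := cPosOn_le P₂ P₃ P₁ k
  have := cPosOn_le P₂ mNone (mOr P₁ P₃) k
  have := cPosOn_le P₃ P₂ P₁ k
  have := cPosOn_le mNone (mOr P₂ P₃) P₁ k
  have := cPosOn_le mNone P₂ (mOr P₁ P₃) k
  have := cPosOn_le P₃ mNone (mOr P₁ P₂) k
  have := cPosOn_le mNone P₃ (mOr P₁ P₂) k
  have := cPosOn_le mNone mNone (mOr (mOr P₁ P₂) P₃) k
  omega

/-- Nine patterns. -/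
lemma cNegE3a_le (P₁ P₂ P₃ : Fin 10 → Bool) (k : Fin 10 → Fin 4) : cNegE3a P₁ P₂ P₃ k ≤ 18 * 59049 := by
  unfold cNegE3a
  have := cNegOn_le (mOr (mOr P₁ P₂) P₃) mNone mNone k
  have := cNegOn_le (mOr P₁ P₂) P₃ mNone k
  have := cNegOn_le (mOr P₁ P₂) mNone P₃ k
  have := cNegOn_le (mOr P₁ P₃) P₂ mNone k
  have := cNegOn_le P₁ (mOr P₂ P₃) mNone k
  have := cNegOn_le P₁ P₂ P₃ k
  have := cNegOn_le (mOr P₁ P₃) mNone P₂ k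
  have := cNegOn_le P₁ P₃ P₂ k
  have := cNegOn_le P₁ mNone (mOr P₂ P₃) k
  omega

/-- Nine patterns. -/
lemma cNegE3b_le (P₁ P₂ P₃ : Fin 10 → Bool) (k : Fin 10 → Fin 4) : cNegE3b P₁ P₂ P₃ k ≤ 18 * 59049 := by
  unfold cNegE3b
  have := cNegOn_le (mOr P₂ P₃) P₁ mNone k
  have := cNegOn_le P₂ (mOr P₁ P₃) mNone k
  have := cNegOn_le P₂ P₁ P₃ k
  have := cNegOn_le P₃ (mOr P₁ P₂) mNone k
  have := cNegOn_le mNone (mOr (mOr P₁ P₂) P₃) mNone k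
  have := cNegOn_le mNone (mOr P₁ P₂) P₃ k
  have := cNegOn_le P₃ P₁ P₂ k
  have := cNegOn_le mNone (mOr P₁ P₃) P₂ k
  have := cNegOn_le mNone P₁ (mOr P₂ P₃) k
  omega

/-- Nine patterns. -/
lemma cNegE3c_le (P₁ P₂ P₃ : Fin 10 → Bool) (k : Fin 10 → Fin 4) : cNegE3c P₁ P₂ P₃ k ≤ 18 * 59049 := by
  unfold cNegE3c
  have := cNegOn_le (mOr P₂ P₃) mNone P₁ k
  have := cNegOn_le P₂ P₃ P₁ k
  have := cNegOn_le P₂ mNone (mOr P₁ P₃) k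
  have := cNegOn_le P₃ P₂ P₁ k
  have := cNegOn_le mNone (mOr P₂ P₃) P₁ k
  have := cNegOn_le mNone P₂ (mOr P₁ P₃) k
  have := cNegOn_le P₃ mNone (mOr P₁ P₂) k
  have := cNegOn_le mNone P₃ (mOr P₁ P₂) k
  have := cNegOn_le mNone mNone (mOr (mOr P₁ P₂) P₃) k
  omega

/-- `KB3 = 8388608`. -/
lemma KB3_val : KB3 = 8388608 := by rw [KB3_eq]; norm_num

/-- The `M` coefficients are below `KB3` (`24 · 3^10 < 2^23`). -/
lemma cPosM_lt (D P : Fin 10 → Bool) (k : Fin 10 → Fin 4) : cPosM D P k < KB3 := by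
  unfold cPosM; rw [KB3_val]
  have := cPosT1e1_le D P k; have := cNegT1_le D k; omega

/-- The `M` coefficients are below `KB3`. -/
lemma cNegM_lt (D P : Fin 10 → Bool) (k : Fin 10 → Fin 4) : cNegM D P k < KB3 := by
  unfold cNegM; rw [KB3_val]
  have := cNegT1e1_le D P k; have := cPosT1_le D k; omega

/-- The `TvT` coefficients are below `KB3` (`60 · 3^10 < 2^23`). -/
lemma cPosTvT_lt (a b c : ℕ) (k : Fin 10 → Fin 4) : cPosTvT a b c k < KB3 := by
  unfold cPosTvT cPosE3; rw [KB3_val]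
  have := cPosE3a_le (pairMask a b) (pairMask a c) (pairMask b c) k
  have := cPosE3b_le (pairMask a b) (pairMask a c) (pairMask b c) k
  have := cPosE3c_le (pairMask a b) (pairMask a c) (pairMask b c) k
  have := cNegT1_le (triMask a b c) k
  omega

/-- The `TvT` coefficients are below `KB3`. -/
lemma cNegTvT_lt (a b c : ℕ) (k : Fin 10 → Fin 4) : cNegTvT a b c k < KB3 := by
  unfold cNegTvT cNegE3; rw [KB3_val]
  have := cNegE3a_le (pairMask a b) (pairMask a c) (pairMask b c) k
  have := cNegE3b_le (pairMask a b) (pairMask a c) (pairMask b c) k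
  have := cNegE3c_le (pairMask a b) (pairMask a c) (pairMask b c) k
  have := cPosT1_le (triMask a b c) k
  omega

/-! ### The coefficient inequalities -/

/-- **`M(H, T, e) ≥ 0` at every `K₅` profile**, from its certificate. -/
theorem cNegM_le_cPosM (D P : Fin 10 → Bool) (hc : CertLE (kNegM D P) (kPosM D P)) (k : Fin 10 → Fin 4) :
    cNegM D P k ≤ cPosM D P k :=
  le_of_certLE (cPosM D P) (cNegM D P) (cPosM_lt D P) (cNegM_lt D P) (kPosM_eq D P) (kNegM_eq D P) hc k

/-- **`TvT-(ii) ≥ 0` at every `K₅` profile**, from its certificate. -/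
theorem cNegTvT_le_cPosTvT (a b c : ℕ) (hc : CertLE (kNegTvT a b c) (kPosTvT a b c)) (k : Fin 10 → Fin 4) :
    cNegTvT a b c k ≤ cPosTvT a b c k :=
  le_of_certLE (cPosTvT a b c) (cNegTvT a b c) (cPosTvT_lt a b c) (cNegTvT_lt a b c) (kPosTvT_eq a b c)
    (kNegTvT_eq a b c) hc k

end Coefficients

end K5

end Summit.Ventures.PercRepro2
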